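import Summits.Ventures.HodgeRepro2.T5BergmanMatrixCoeff

/-!
# Bi-`K`-equivariance of the `K`-finite matrix coefficients (Rühl's bicovariant form)

For the monomials `zᵐ, zⁿ` (the `K`-finite vectors of weights `k+2m`, `k+2n`) the matrix coefficient
`g ↦ ⟨π_k(g) zᵐ, zⁿ⟩_k` is bi-`K`-equivariant:

  `⟨π_k(rot u · g · rot v) zᵐ, zⁿ⟩_k = u^{-(k+2n)} v^{-(k+2m)} ⟨π_k(g) zᵐ, zⁿ⟩_k`

(`matrixCoeff_monomial_rot_mul_mul_rot`). With the Cartan decomposition `g = rot u · a_t · rot v`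
(`T5SU11Cartan.exists_cartan`) every such coefficient is `u^{-(k+2n)} v^{-(k+2m)}` times its value on
the hyperbolic one-parameter subgroup `a_t` (`matrixCoeff_monomial_cartan`) — Rühl §6-4's bicovariant
form `exp{i(q₁ψ₁ + q₂ψ₂)} d^J_{q₁q₂}(cosh η)` with `q₁ = k_R + n`, `q₂ = k_R + m`, `J = k_R`, `η = 2t`; the
`d`-function is the coefficient on `a_t`. The left equivariance is unitarity plus `π_k(rot u) zⁿ =
u^{-(k+2n)} zⁿ`; the right one is `T5BergmanMatrixCoeff.matrixCoeff_monomial_mul_rot`.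

Blind lane: Mathlib + the HodgeRepro2 prefix only; no sorry; axioms ⊆ {propext, Classical.choice,
Quot.sound}.
-/

namespace Summit.Ventures.HodgeRepro2.T5BergmanCoeffCartan

open Metric
open T5SU11Unimodular T5SU11Fibration T5SU11Cartan
open T5BergmanCoefficient T5BergmanPairing T5BergmanUnitary T5BergmanCoefficientL2 T5BergmanActStable
  T5BergmanMatrixCoeff

/-- **Left `K`-equivariance on the monomial in the second slot**:
`⟨π_k(rot u · g) f, zⁿ⟩_k = u^{-(k+2n)} ⟨π_k(g) f, zⁿ⟩_k` (unitarity and `π_k(rot u⁻¹) zⁿ = u^{k+2n} zⁿ`). -/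
theorem matrixCoeff_rot_mul_monomial (k n : ℕ) (hk : 2 ≤ k) (f : ℂ → ℂ) (u : Circle) (g : SU11) :
    matrixCoeff k f (fun w => w ^ n) (rot u * g) =
      ((u : ℂ)⁻¹) ^ (k + 2 * n) * matrixCoeff k f (fun w => w ^ n) g := by
  unfold matrixCoeff
  rw [pairing_act_mul, pairing_act_left k hk (rot u), ← map_inv]
  have e : ∀ z, act k (rot u⁻¹) (fun w => w ^ n) z = (u : ℂ) ^ (k + 2 * n) * z ^ n := by
    intro z
    rw [act_rot_monomial, Circle.coe_inv, inv_inv]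
  rw [pairing_congr (fun _ _ => rfl) (fun z _ => e z), pairing_smul_right, map_pow,
    ← Circle.coe_inv_eq_conj, Circle.coe_inv]

/-- **Bi-`K`-equivariance of the `K`-finite coefficients**:
`⟨π_k(rot u · g · rot v) zᵐ, zⁿ⟩_k = u^{-(k+2n)} v^{-(k+2m)} ⟨π_k(g) zᵐ, zⁿ⟩_k`. -/
theorem matrixCoeff_monomial_rot_mul_mul_rot (k m n : ℕ) (hk : 2 ≤ k) (u v : Circle) (g : SU11) :
    matrixCoeff k (fun w => w ^ m) (fun w => w ^ n) (rot u * g * rot v) =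
      ((u : ℂ)⁻¹) ^ (k + 2 * n) * (((v : ℂ)⁻¹) ^ (k + 2 * m) *
        matrixCoeff k (fun w => w ^ m) (fun w => w ^ n) g) := by
  rw [matrixCoeff_monomial_mul_rot, matrixCoeff_rot_mul_monomial k n hk]
  ring

/-- **Rühl's bicovariant form**: every `K`-finite coefficient is, in Cartan coordinates
`g = rot u · a_t · rot v` (`t ≥ 0`), `u^{-(k+2n)} v^{-(k+2m)}` times its value on `a_t`. -/
theorem matrixCoeff_monomial_cartan (k m n : ℕ) (hk : 2 ≤ k) (g : SU11) :
    ∃ (u v : Circle) (t : ℝ), 0 ≤ t ∧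
      matrixCoeff k (fun w => w ^ m) (fun w => w ^ n) g =
        ((u : ℂ)⁻¹) ^ (k + 2 * n) * (((v : ℂ)⁻¹) ^ (k + 2 * m) *
          matrixCoeff k (fun w => w ^ m) (fun w => w ^ n) (hyp t)) := by
  obtain ⟨u, v, t, ht, hg⟩ := exists_cartan g
  exact ⟨u, v, t, ht, by rw [hg, matrixCoeff_monomial_rot_mul_mul_rot k m n hk]⟩

end Summit.Ventures.HodgeRepro2.T5BergmanCoeffCartan
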